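import Literature.MathematicalPhysics.QuantumFieldTheory.Balaban1983to89.B12Ineq341Rotation
import Literature.MathematicalPhysics.QuantumFieldTheory.Balaban1983to89.B12Eq18Current
import Literature.MathematicalPhysics.QuantumFieldTheory.Balaban1983to89.B12Lemma4Concrete

/-!
# `Balaban1983to89.B12Eq338CondIV` — T. Bałaban, *Renormalization group approach to lattice gauge field theories. I*,
Commun. Math. Phys. **109** (1987) 249–301 [Balaban1987RG1]: **the identity (3.38) p. 278 and «the condition (iv) is a consequence
of the condition (iii), with a bit better constant»** — the MECHANISM on the carriers of record (`B12RegularSpaces111`: the (iv)-data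
`Frame.bg.Un n`, `Frame.bg.Jn n` of (1.15), the plaquette variables `plaq`, the gauge action `gaugeU`, the step constants
`StepConsts`; `B12Eq18Current.current` = the current (1.8); `B12Ineq341Rotation`: rotation costs): until now condition (iv) (1.16) for
the configuration `exp iξ𝐇_j(□₀, τQ(L⁻¹η𝐇_{k+1}) [+ B′])` of (3.36)/Lemma 4 and for its `G`-factor `U = 1` were the literal hypotheses
`hIV`, `hIV₁ : CondIV …` of `B12Lemma4Concrete.satisfies_expI`, `B12Lemma4Space.mem_space'_lemma4`, `B12Lemma4Chain.*`,
`B12Lemma4Models.*`.  Here both halves of (iv) are DERIVED from their printed source.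

HONEST FRAMING (cell `lit-balaban`, verbatim): statement-level skeleton of published theorems with citation tags; proofs where landed; nothing here is a claim about the Yang–Mills mass gap.

PDF held: `paper:balaban1987-cmp109-rg-i-small-field` (journal page = PDF page + 248); pp. 262, 277, 278 re-read as images from the
renders `b2b-balaban-ref1/pages/1987-cmp109-rg-I-small-field/1987-cmp109-rg-I-small-field-p014/p029/p030-x2.png` by this unit.

THE PRINT, verbatim.  p. 262, (iv): *«We consider X as Ω₀, and we construct the sequence {Ω_n}, n = 1, …, j, … we construct the
functions U_n(V) in the axial gauges, for regular Gᶜ-valued configurations V. We consider the pair (U_n(M˙(𝐔)), J_n(M˙(𝐔))),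
n = 1, …, j, (1.15) where M˙(𝐔, b) = M^p(𝐔, b) = Ū^p(b) for b ∈ Λ_p (see (1.5) [14]), and J_n(M˙(𝐔)) is defined by the formula (1.8)
with U_n(M˙(𝐔)) instead of U_j, L⁻ⁿ instead of ξ. This pair satisfies the bounds |∂U_n(M˙(𝐔)) − 1| < α₀ξ², |J_n(M˙(𝐔))| < α₀(Lⁿξ)² on
X̃⁻², (1.16) and the same bounds hold for U instead of 𝐔.»*  p. 277, (3.37): *«U_j(□₀, exp iτQ(L⁻¹η𝐇_{k+1})) = (exp iξ𝐇_j(□₀,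
τQ(L⁻¹η𝐇_{k+1})))^{u_j}, … |u_j − 1| < B₃²O(1)Mα₀.»*  p. 278: *«The following identity holds:
U_n(X, M˙(exp iξ𝐇_j(□₀, τQ(L⁻¹η𝐇_{k+1})))) = U_n(X, M˙(U_j(□₀, exp iτQ(L⁻¹η𝐇_{k+1}))))^{(ū_j)⁻¹} = U_j(□₀, exp iτQ(L⁻¹η𝐇_{k+1}))^{(ū_j)⁻¹}
= (exp iξ𝐇_j(□₀, τQ(L⁻¹η𝐇_{k+1})))^{u_j(ū_j)⁻¹}, (3.38) where ū_j is a gauge transformation constant on blocks naturally connected with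
the function U_n(X, ·), and equal to u_j at centers of the blocks. This identity and the bound on u_j in (3.37) imply that the condition
(iv) is a consequence of the condition (iii), with a bit better constant, for the pair of configurations exp iξ𝐇_j(…),
D^{ξ*}_{exp iξ𝐇_j(…)}ξ⁻²π Im ∂ exp iξ𝐇_j(…).»*; p. 280: *«The condition (iv) follows from the corresponding identity (3.38).»*

THE READING.  `V = exp iξ𝐇_j(□₀, τQ(…) [+ B′])`, `w_n = u_j(ū_j)⁻¹` (site-wise `u_j · ū_j⁻¹`; `ū_j` depends on `n` through «blocks naturally
connected with the function U_n(X, ·)», each «equal to u_j at centers of the blocks»: `ū n x = u_j (ctr n x)`).  (3.38) says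
`U_n(X, M˙(V)) = V^{w_n}` ((1.10), `gaugeU`); it enters, as (3.39)/(3.42) enter `B12Ineq341Rotation`, at the level of the quantities (1.16)
constrains: the plaquette variables of `F.bg.Un n V` on `X̃⁻²` (`h338`), and — composing the DEFINITION sentence of p. 262 «J_n(M˙(𝐔)) is
defined by the formula (1.8) with U_n(M˙(𝐔)) instead of U_j, L⁻ⁿ instead of ξ» with (3.38) — `F.bg.Jn n V b = current π L⁻ⁿ (V^{w_n}) b` on
the bonds of `X̃⁻²` (`hJn`).  ROTATION: `∂(V^w)(p) = R(w(x))∂V(p)` (`plaq_gaugeU`), `J(V^w) = R(w)J(V)` (`current_gaugeU`, `π` commuting with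
`Ad` of the values of `w`) at the cost `‖w(x)‖‖w(x)⁻¹‖ ≤ e^{B₃²O(1)Mα₀}·e^{B₃²O(1)Mα₀}` («the bound on u_j in (3.37)», one exponential factor per
transformation as in (3.41); `ū_j` costs what `u_j` costs).  SCALING: the current at the parameter `L⁻ⁿ` is `(Lⁿξ)³` times the current at
`ξ` (`current_scale`), `Lⁿξ = L^{n−j} ≤ 1`.  Hence (iii)-type bounds `|∂V − 1| < α₀′ξ²`, `|J(V)| < γ₀′` on `X̃⁻²` with constants «a bit
better» than `α₀` (`e^{2B₃²O(1)Mα₀}α₀′ ≤ α₀`, `e^{2B₃²O(1)Mα₀}γ₀′ ≤ α₀`) give (iv); for `U = 1` («the same bounds hold for U»; the factorisation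
`V = (exp iξA′)·1` of pp. 277/280) (3.38) at `τ = 0`, `B′ = 0` makes `U_n(M˙(1)) = 1^{w}` a pure gauge: plaquettes `1`, current `0`.
THE MARGIN: Lemma 4's proof delivers (iii) as (3.47) `< (1+7β)L⁻²α₀ξ²` / (3.52) `< (1+8β)L⁻²α₀ξ²` (J-half below the same count,
`B12CondIIIJ.jBudget_lt`), «a bit better» than `α₀ξ²` iff `(1+8β)L⁻² < 1`; the printed restrictions («1 + 8β ≤ L²», p. 279 «(1+7β)L⁻² ≤ 1
for β not too large») leave NO room for `e^{2B₃²O(1)Mα₀}` (LOCATED: `margin_not_from_restrictions`); one more restriction of the printed kind,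
`1 + 10β ≤ L²`, closes it (`margin352_of_restrictions`: `e^{2B₃²O(1)Mα₀} ≤ e^{β/8} ≤ 1 + 9β/64` from «(4B₃²O(1)M)²α₀ ≤ β», `B₃²O(1)M ≥ 1`).

WHAT IS PROVED.  §1 `cost_mul_inv_le` (cost of `u_j·ū_j⁻¹` from the cost of `u_j` and `ū = u_j ∘ ctr`).  §2 `condIV_plaq_of_eq338`
(plaquette half of (iv) from `h338`, costs, `|∂V − 1| < α₀′ξ²`, `Eα₀′ ≤ α₀`).  §3 `imPlaq_eq_smul`, `current_eq_smul`, `current_scale`,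
`norm_current_scale` (the current (1.8) under a change of the parameter `ξ`), `scale_pow_le_one`.  §4 `condIV_J_of_eq338` (J-half of (iv)
from `hJn`, costs, `|J(V)| < γ₀′`, `Eγ₀′ ≤ α₀`).  §5 `condIV_of_eq338` ((iv) for `V`), `plaq_gaugeU_one`, `current_one`, `condIV_one_of_eq338`
((iv) for `U = 1`), `satisfies_expI_of_eq338` ((i)–(iv) for a pair `(exp iξ𝐊, 𝐉)` with (iv) DERIVED — `B12Lemma4Concrete.satisfies_expI`
without `hIV`/`hIV₁`).  §6 the margin: `exp_two_mul_le`, `margin352`, `margin352_of_restrictions` (the count `1+7β` of (3.47) a fortiori),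
`margin_not_from_restrictions`.  NOT here (hypotheses, by reference, as everywhere in the Lemma-4 files): the functions `U_n(X, M˙(·))`,
`J_n`, `𝐇_j`, `u_j`, `ū_j` of [14, 15] and the identity (3.38) itself; the (iii)-type bounds with the better constants for the concrete
Lemma-4 data (the (3.52)/J-budget members; sibling files).  No `def`, no `Prop` placeholder, no new fact; axioms standard.
Unit `lit-balaban-p07` (Phase-2 seat p07 gen 6; TAKING line HOME/STATUS.md 2026-08-21T07:47:03Z; rows B12.Eq3.37-3.47 / B12.Eq1.15-1.16 /
B12.Lem4, owners r09/r20), HOME `run/shared/lean/pub/lit-balaban/`.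
-/

namespace Literature.MathematicalPhysics.QuantumFieldTheory.Balaban1983to89.B12Eq338CondIV

open Literature.MathematicalPhysics.QuantumFieldTheory.Balaban1983to89
open Literature.MathematicalPhysics.QuantumFieldTheory.Balaban1983to89.B9Eq39Adjoint
open Literature.MathematicalPhysics.QuantumFieldTheory.Balaban1983to89.B9TorusCalculus
open Literature.MathematicalPhysics.QuantumFieldTheory.Balaban1983to89.B12RegularSpaces111
open Literature.MathematicalPhysics.QuantumFieldTheory.Balaban1983to89.B12RegularSpaces111Gauge
open Literature.MathematicalPhysics.QuantumFieldTheory.Balaban1983to89.B12Ineq341Rotation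
open Literature.MathematicalPhysics.QuantumFieldTheory.Balaban1983to89.B12Eq18Current

noncomputable section

/-! ## §1. The cost of `w = u_j(ū_j)⁻¹`, «ū_j … equal to u_j at centers of the blocks» -/

section Cost

variable {S : Type*} {𝔸 : Type*} [NormedRing 𝔸]

/-- **The rotation of (3.38) costs at most `e^{B₃²O(1)Mα₀}·e^{B₃²O(1)Mα₀}`**: if every value of `u_j` has rotation cost
`‖u_j(y)‖‖u_j(y)⁻¹‖ ≤ e^{a}` («|u_j − 1| < B₃²O(1)Mα₀», (3.37), in the cost form of (3.41)) and `ū` is «equal to u_j at centers of the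
blocks» (`ū x = u_j (ctr x)`), then the site-wise transformation `u_j·ū⁻¹` costs at most `e^{a}e^{a}` at every site.
[cite: Balaban1987RG1, (3.38) p.278] -/
theorem cost_mul_inv_le {uj ubar : S → 𝔸ˣ} {ctr : S → S} {a : ℝ}
    (huj : ∀ y, ‖(uj y : 𝔸)‖ * ‖(↑(uj y)⁻¹ : 𝔸)‖ ≤ Real.exp a) (hubar : ∀ x, ubar x = uj (ctr x)) (x : S) :
    ‖(((uj * ubar⁻¹ : S → 𝔸ˣ) x : 𝔸ˣ) : 𝔸)‖ * ‖((((uj * ubar⁻¹ : S → 𝔸ˣ) x)⁻¹ : 𝔸ˣ) : 𝔸)‖ ≤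
      Real.exp a * Real.exp a := by
  have e : (uj * ubar⁻¹ : S → 𝔸ˣ) x = uj x * (uj (ctr x))⁻¹ := by
    rw [Pi.mul_apply, Pi.inv_apply, hubar]
  rw [e]
  calc _ ≤ (‖(uj x : 𝔸)‖ * ‖(↑(uj x)⁻¹ : 𝔸)‖) *
        (‖(((uj (ctr x))⁻¹ : 𝔸ˣ) : 𝔸)‖ * ‖((((uj (ctr x))⁻¹)⁻¹ : 𝔸ˣ) : 𝔸)‖) := cost_mul_le _ _
    _ = (‖(uj x : 𝔸)‖ * ‖(↑(uj x)⁻¹ : 𝔸)‖) * (‖(uj (ctr x) : 𝔸)‖ * ‖(↑(uj (ctr x))⁻¹ : 𝔸)‖) := by rw [cost_inv]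
    _ ≤ Real.exp a * Real.exp a := mul_le_mul (huj x) (huj (ctr x)) (by positivity) (Real.exp_pos a).le

end Cost

/-! ## §2. (iv), plaquette half: `|∂U_n(M˙(V)) − 1| = |R(w_n)(∂V − 1)| ≤ cost·|∂V − 1|` -/

section Plaq

variable {P : Params} {i : ℕ} {𝔸 : Type*} [NormedRing 𝔸]

/-- **(3.38) ⇒ the first bound of (1.16) for `V`, from the (iii)-type plaquette bound «with a bit better constant».**  For every
`n = 1, …, j` and every plaquette `p ⊂ X̃⁻²` let `∂(U_n(X, M˙(V)))(p) = ∂(V^{w_n})(p)` ((3.38), `h338`), with rotations of cost `≤ E` at the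
base points; if `|∂V(p) − 1| < α₀′ξ²` on `X̃⁻²` and `Eα₀′ ≤ α₀`, then `|∂U_n(X, M˙(V))(p) − 1| < α₀ξ²` on `X̃⁻²`, `n = 1, …, j`.
[cite: Balaban1987RG1, (3.38) p.278 with (1.16) p.262] -/
theorem condIV_plaq_of_eq338 {bg : BackgroundFns P i 𝔸} {X₂ : Region P i} {cs : StepConsts} {α₀ α₀' E : ℝ}
    {V : PBond P i → 𝔸ˣ} {w : ℕ → Site P i → 𝔸ˣ}
    (h338 : ∀ n, 1 ≤ n → n ≤ cs.j → ∀ p ∈ X₂.plaqs, plaq (bg.Un n V) p = plaq (gaugeU (w n) V) p)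
    (hw : ∀ n x, ‖(w n x : 𝔸)‖ * ‖(↑(w n x)⁻¹ : 𝔸)‖ ≤ E) (hE : 0 < E)
    (hV : ∀ p ∈ X₂.plaqs, ‖((plaq V p : 𝔸ˣ) : 𝔸) - 1‖ < α₀' * cs.ξ ^ 2) (hEα : E * α₀' ≤ α₀) :
    ∀ n, 1 ≤ n → n ≤ cs.j → ∀ p ∈ X₂.plaqs, ‖((plaq (bg.Un n V) p : 𝔸ˣ) : 𝔸) - 1‖ < α₀ * cs.ξ ^ 2 := by
  intro n hn hnj p hp
  rw [h338 n hn hnj p hp, plaq_gaugeU, Units.val_mul, Units.val_mul]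
  have hξ2 : 0 ≤ cs.ξ ^ 2 := sq_nonneg _
  calc ‖(w n p.src : 𝔸) * ↑(plaq V p) * ↑(w n p.src)⁻¹ - 1‖
      ≤ ‖(w n p.src : 𝔸)‖ * ‖(↑(w n p.src)⁻¹ : 𝔸)‖ * ‖((plaq V p : 𝔸ˣ) : 𝔸) - 1‖ := norm_conj_sub_one_le_cost _ _
    _ ≤ E * ‖((plaq V p : 𝔸ˣ) : 𝔸) - 1‖ := mul_le_mul_of_nonneg_right (hw n p.src) (norm_nonneg _)
    _ < E * (α₀' * cs.ξ ^ 2) := mul_lt_mul_of_pos_left (hV p hp) hE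
    _ = (E * α₀') * cs.ξ ^ 2 := by ring
    _ ≤ α₀ * cs.ξ ^ 2 := mul_le_mul_of_nonneg_right hEα hξ2

/-- The plaquette variables of a pure gauge `1^{w}` are `1` («the same bounds hold for U»: for `U = 1`, `U_n(M˙(1)) = 1^{w}` by (3.38) at
`τ = 0`). [cite: Balaban1987RG1, (3.38) p.278] -/
theorem plaq_gaugeU_one (w : Site P i → 𝔸ˣ) (p : Plaq P i) : plaq (gaugeU w (1 : PBond P i → 𝔸ˣ)) p = 1 := by
  rw [plaq_gaugeU, B12RegularSpaces111Mono.plaq_one, mul_one, mul_inv_cancel]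

end Plaq

/-! ## §3. The current (1.8) under a change of the parameter `ξ`: «L⁻ⁿ instead of ξ» -/

section Scaling

variable {P : Params} {i : ℕ} {𝔸 : Type*} [Ring 𝔸] [Algebra ℂ 𝔸]

/-- `ξ⁻²π Im ∂𝐔 = (ξ⁻¹)²·(π Im ∂𝐔)`: the parameter enters the plaquette function of (1.8) only through the prefactor.
[cite: Balaban1987RG1, (1.8) p.261] -/
theorem imPlaq_eq_smul (π : 𝔸 →ₗ[ℂ] 𝔸) (s : ℝ) (U : PBond P i → 𝔸ˣ) :
    imPlaq π s U = ((s : ℂ)⁻¹) ^ 2 • fun μ ν x => π (B9Eq37Insertion.imC (plaqU (torusT P i) (dirForm U) μ ν x)) := by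
  funext μ ν x
  rfl

/-- **`J = D^{ξ*}ξ⁻²π Im ∂𝐔 = ξ⁻³·D*(π Im ∂𝐔)`** (`D^{ξ*} = ξ⁻¹D*`, `D*` linear): the parameter enters (1.8) only through `ξ⁻³`.
[cite: Balaban1987RG1, (1.8) p.261] -/
theorem current_eq_smul (π : 𝔸 →ₗ[ℂ] 𝔸) (s : ℝ) (U : PBond P i → 𝔸ˣ) (b : PBond P i) :
    current π s U b = ((s : ℂ)⁻¹) ^ 3 •
      divP (torusT P i) (dirForm U) (fun μ ν x => π (B9Eq37Insertion.imC (plaqU (torusT P i) (dirForm U) μ ν x)))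
        b.dir b.src := by
  rw [current_apply, imPlaq_eq_smul, divP_smul, smul_smul]
  congr 1
  ring

/-- **«(1.8) with … L⁻ⁿ instead of ξ»: the current at parameter `s` is `(t/s)³` times the current at parameter `t`** (`t ≠ 0`; in (1.16):
`s = L⁻ⁿ`, `t = ξ = L⁻ʲ`, `t/s = Lⁿξ`). [cite: Balaban1987RG1, (1.15) p.262] -/
theorem current_scale (π : 𝔸 →ₗ[ℂ] 𝔸) {s t : ℝ} (ht : t ≠ 0) (U : PBond P i → 𝔸ˣ) (b : PBond P i) :
    current π s U b = (((t : ℂ) / (s : ℂ)) ^ 3) • current π t U b := by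
  rw [current_eq_smul π s, current_eq_smul π t, smul_smul]
  congr 1
  have ht' : (t : ℂ) ≠ 0 := Complex.ofReal_ne_zero.mpr ht
  rw [← mul_pow, div_mul_eq_mul_div, mul_inv_cancel₀ ht', one_div]

/-- A pure gauge has no current: `J(1) = 0` at every parameter (`Im ∂1 = Im 1 = 0`). [cite: Balaban1987RG1, (1.8) p.261] -/
theorem current_one (π : 𝔸 →ₗ[ℂ] 𝔸) (s : ℝ) : current π s (1 : PBond P i → 𝔸ˣ) = 0 := by
  funext b
  rw [current_eq_smul, Pi.zero_apply]
  have h0 : (fun μ ν x => π (B9Eq37Insertion.imC (plaqU (torusT P i) (dirForm (1 : PBond P i → 𝔸ˣ)) μ ν x))) =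
      (0 : ℂ) • (fun _ _ _ => (0 : 𝔸)) := by
    funext μ ν x
    simp [plaqU, B9Eq37Insertion.imC_one]
  rw [h0, divP_smul, zero_smul, smul_zero]

variable {𝔹 : Type*} [NormedRing 𝔹] [NormedAlgebra ℂ 𝔹]

/-- The norm form: `|J_s(𝐔)(b)| = (t/s)³|J_t(𝐔)(b)|` for `0 < s, t`. [cite: Balaban1987RG1, (1.15) p.262] -/
theorem norm_current_scale (π : 𝔹 →ₗ[ℂ] 𝔹) {s t : ℝ} (hs : 0 < s) (ht : 0 < t) (U : PBond P i → 𝔹ˣ) (b : PBond P i) :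
    ‖current π s U b‖ = (t / s) ^ 3 * ‖current π t U b‖ := by
  rw [current_scale π ht.ne' U b, norm_smul, norm_pow, ← Complex.ofReal_div, Complex.norm_real,
    Real.norm_of_nonneg (div_nonneg ht.le hs.le)]

/-- `0 < Lⁿξ ≤ 1` for `n ≤ j` (`ξ = L⁻ʲ`: `L^jξ = 1`, `L ≥ 1`) — «L⁻ⁿ instead of ξ» is a coarser parameter. [cite: Balaban1987RG1, (1.16) p.262] -/
theorem scale_pow_le_one {cs : StepConsts} (hξ : 0 < cs.ξ) (hL : 1 ≤ cs.L) (hLξ : cs.L ^ cs.j * cs.ξ = 1) {n : ℕ}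
    (hn : n ≤ cs.j) : 0 < cs.L ^ n * cs.ξ ∧ cs.L ^ n * cs.ξ ≤ 1 := by
  have hL0 : 0 < cs.L := by linarith
  refine ⟨by positivity, ?_⟩
  calc cs.L ^ n * cs.ξ ≤ cs.L ^ cs.j * cs.ξ := mul_le_mul_of_nonneg_right (pow_le_pow_right₀ hL hn) hξ.le
    _ = 1 := hLξ

end Scaling

/-! ## §4. (iv), J half: `|J_n(M˙(V))| = |R(w_n)(Lⁿξ)³J(V)| ≤ cost·(Lⁿξ)³|J(V)|` -/

section JHalf

variable {P : Params} {i : ℕ} {𝔸 : Type*} [NormedRing 𝔸] [NormedAlgebra ℂ 𝔸]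

/-- **(3.38) ⇒ the second bound of (1.16) for `V`, from the (iii)-type current bound «with a bit better constant».**  For `n = 1, …, j`
and `b ⊂ X̃⁻²` let `J_n(M˙(V))(b) = ((1.8) at the parameter L⁻ⁿ)(V^{w_n})(b)` (p. 262 definition sentence with (3.38): `hJn`), `π` commute
with `Ad` of the values of the `w_n`, the rotations cost `≤ E`; if `|J(V)(b)| < γ₀′` on `X̃⁻²` (`J = B12Eq18Current.current π ξ`) and
`Eγ₀′ ≤ α₀`, then `|J_n(M˙(V))(b)| < α₀(Lⁿξ)²` on `X̃⁻²` — by covariance `J(V^w) = R(w)J(V)`, the scaling `(Lⁿξ)³` and `Lⁿξ ≤ 1`.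
[cite: Balaban1987RG1, (3.38) p.278 with (1.15)–(1.16) p.262] -/
theorem condIV_J_of_eq338 {bg : BackgroundFns P i 𝔸} {X₂ : Region P i} {cs : StepConsts} (π : 𝔸 →ₗ[ℂ] 𝔸)
    {α₀ γ₀' E : ℝ} {V : PBond P i → 𝔸ˣ} {w : ℕ → Site P i → 𝔸ˣ}
    (hξ : 0 < cs.ξ) (hL : 1 ≤ cs.L) (hLξ : cs.L ^ cs.j * cs.ξ = 1)
    (hJn : ∀ n, 1 ≤ n → n ≤ cs.j → ∀ b ∈ X₂.bonds, bg.Jn n V b = current π (cs.L ^ n)⁻¹ (gaugeU (w n) V) b)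
    (hπ : ∀ n x X, π (R (w n x) X) = R (w n x) (π X))
    (hw : ∀ n x, ‖(w n x : 𝔸)‖ * ‖(↑(w n x)⁻¹ : 𝔸)‖ ≤ E) (hE : 0 < E)
    (hJ : ∀ b ∈ X₂.bonds, ‖current π cs.ξ V b‖ < γ₀') (hEγ : E * γ₀' ≤ α₀) :
    ∀ n, 1 ≤ n → n ≤ cs.j → ∀ b ∈ X₂.bonds, ‖bg.Jn n V b‖ < α₀ * (cs.L ^ n * cs.ξ) ^ 2 := by
  intro n hn hnj b hb
  obtain ⟨hr0, hr1⟩ := scale_pow_le_one hξ hL hLξ hnj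
  have hL0 : 0 < cs.L := by linarith
  have hsn : 0 < (cs.L ^ n)⁻¹ := inv_pos.mpr (pow_pos hL0 n)
  have hratio : cs.ξ / (cs.L ^ n)⁻¹ = cs.L ^ n * cs.ξ := by rw [div_inv_eq_mul, mul_comm]
  have hsc : ‖current π (cs.L ^ n)⁻¹ V b‖ = (cs.L ^ n * cs.ξ) ^ 3 * ‖current π cs.ξ V b‖ := by
    rw [norm_current_scale π hsn hξ V b, hratio]
  have hγ : 0 ≤ γ₀' := (norm_nonneg _).trans (hJ b hb).le
  have hr2 : 0 < (cs.L ^ n * cs.ξ) ^ 2 := by positivity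
  have hr32 : (cs.L ^ n * cs.ξ) ^ 3 ≤ (cs.L ^ n * cs.ξ) ^ 2 := by
    calc (cs.L ^ n * cs.ξ) ^ 3 = (cs.L ^ n * cs.ξ) ^ 2 * (cs.L ^ n * cs.ξ) := by ring
      _ ≤ (cs.L ^ n * cs.ξ) ^ 2 * 1 := mul_le_mul_of_nonneg_left hr1 hr2.le
      _ = (cs.L ^ n * cs.ξ) ^ 2 := mul_one _
  rw [hJn n hn hnj b hb, current_gaugeU π _ (w n) (hπ n) V b, R_def]
  calc ‖(w n b.src : 𝔸) * current π (cs.L ^ n)⁻¹ V b * ↑(w n b.src)⁻¹‖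
      ≤ ‖(w n b.src : 𝔸)‖ * ‖(↑(w n b.src)⁻¹ : 𝔸)‖ * ‖current π (cs.L ^ n)⁻¹ V b‖ := norm_conj_le_cost _ _
    _ ≤ E * ‖current π (cs.L ^ n)⁻¹ V b‖ := mul_le_mul_of_nonneg_right (hw n b.src) (norm_nonneg _)
    _ = E * (cs.L ^ n * cs.ξ) ^ 3 * ‖current π cs.ξ V b‖ := by rw [hsc]; ring
    _ < E * (cs.L ^ n * cs.ξ) ^ 3 * γ₀' := mul_lt_mul_of_pos_left (hJ b hb) (by positivity)
    _ ≤ E * (cs.L ^ n * cs.ξ) ^ 2 * γ₀' :=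
        mul_le_mul_of_nonneg_right (mul_le_mul_of_nonneg_left hr32 hE.le) hγ
    _ = (E * γ₀') * (cs.L ^ n * cs.ξ) ^ 2 := by ring
    _ ≤ α₀ * (cs.L ^ n * cs.ξ) ^ 2 := mul_le_mul_of_nonneg_right hEγ hr2.le

end JHalf

/-! ## §5. Condition (iv) for `V` and for `U = 1`; (i)–(iv) for the pair `(exp iξ𝐊, 𝐉)` with (iv) derived -/

section CondIV

variable {P : Params} {i : ℕ} {𝔸 : Type*} [NormedRing 𝔸] [NormedAlgebra ℂ 𝔸]

/-- **«the condition (iv) is a consequence of the condition (iii), with a bit better constant»** — condition (iv) (1.16) of the frame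
`(bg, X̃⁻², cs)` with constant `α₀` for a configuration `V` whose (iv)-data are given by (3.38) (`h338`, `hJn`, rotations `w_n` of cost
`≤ E`, `π` commuting with their `Ad`), from the (iii)-type bounds `|∂V − 1| < α₀′ξ²`, `|J(V)| < γ₀′` on `X̃⁻²` with `Eα₀′ ≤ α₀`, `Eγ₀′ ≤ α₀`.
[cite: Balaban1987RG1, (3.38) p.278 with (1.16) p.262] -/
theorem condIV_of_eq338 {bg : BackgroundFns P i 𝔸} {X₂ : Region P i} {cs : StepConsts} (π : 𝔸 →ₗ[ℂ] 𝔸)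
    {α₀ α₀' γ₀' E : ℝ} {V : PBond P i → 𝔸ˣ} {w : ℕ → Site P i → 𝔸ˣ}
    (hξ : 0 < cs.ξ) (hL : 1 ≤ cs.L) (hLξ : cs.L ^ cs.j * cs.ξ = 1)
    (h338 : ∀ n, 1 ≤ n → n ≤ cs.j → ∀ p ∈ X₂.plaqs, plaq (bg.Un n V) p = plaq (gaugeU (w n) V) p)
    (hJn : ∀ n, 1 ≤ n → n ≤ cs.j → ∀ b ∈ X₂.bonds, bg.Jn n V b = current π (cs.L ^ n)⁻¹ (gaugeU (w n) V) b)
    (hπ : ∀ n x X, π (R (w n x) X) = R (w n x) (π X))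
    (hw : ∀ n x, ‖(w n x : 𝔸)‖ * ‖(↑(w n x)⁻¹ : 𝔸)‖ ≤ E) (hE : 0 < E)
    (hV : ∀ p ∈ X₂.plaqs, ‖((plaq V p : 𝔸ˣ) : 𝔸) - 1‖ < α₀' * cs.ξ ^ 2) (hEα : E * α₀' ≤ α₀)
    (hJ : ∀ b ∈ X₂.bonds, ‖current π cs.ξ V b‖ < γ₀') (hEγ : E * γ₀' ≤ α₀) :
    CondIV bg X₂ cs α₀ V :=
  ⟨condIV_plaq_of_eq338 h338 hw hE hV hEα, condIV_J_of_eq338 π hξ hL hLξ hJn hπ hw hE hJ hEγ⟩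

/-- **«and the same bounds hold for U instead of 𝐔» for the factor `U = 1`**: with the (iv)-data of `1` given by (3.38) (at `τ = 0`,
`B′ = 0`: `U_n(M˙(1)) = 1^{w_n}` a pure gauge, `J_n(M˙(1)) = ((1.8) at L⁻ⁿ)(1^{w_n})`), condition (iv) holds for `U = 1` with any
`α₀ > 0`: the plaquette variables are `1` and the current vanishes. [cite: Balaban1987RG1, (3.38) p.278 with (1.16) p.262] -/
theorem condIV_one_of_eq338 {bg : BackgroundFns P i 𝔸} {X₂ : Region P i} {cs : StepConsts} (π : 𝔸 →ₗ[ℂ] 𝔸) {α₀ : ℝ}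
    {w : ℕ → Site P i → 𝔸ˣ} (hα₀ : 0 < α₀) (hξ : 0 < cs.ξ) (hL : 1 ≤ cs.L)
    (h338 : ∀ n, 1 ≤ n → n ≤ cs.j → ∀ p ∈ X₂.plaqs,
      plaq (bg.Un n (1 : PBond P i → 𝔸ˣ)) p = plaq (gaugeU (w n) (1 : PBond P i → 𝔸ˣ)) p)
    (hJn : ∀ n, 1 ≤ n → n ≤ cs.j → ∀ b ∈ X₂.bonds,
      bg.Jn n (1 : PBond P i → 𝔸ˣ) b = current π (cs.L ^ n)⁻¹ (gaugeU (w n) (1 : PBond P i → 𝔸ˣ)) b)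
    (hπ : ∀ n x X, π (R (w n x) X) = R (w n x) (π X)) :
    CondIV bg X₂ cs α₀ (1 : PBond P i → 𝔸ˣ) := by
  have hL0 : 0 < cs.L := by linarith
  refine ⟨fun n hn hnj p hp => ?_, fun n hn hnj b hb => ?_⟩
  · rw [h338 n hn hnj p hp, plaq_gaugeU_one, Units.val_one, sub_self, norm_zero]
    positivity
  · rw [hJn n hn hnj b hb, current_gaugeU π _ (w n) (hπ n) _ b, current_one, Pi.zero_apply, R_zero, norm_zero]
    positivity

variable [CompleteSpace 𝔸] (𝓜 : Model 𝔸)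

/-- **(i)–(iv) for a pair `(exp iξ𝐊, 𝐉)` with (iv) DERIVED** — `B12Lemma4Concrete.satisfies_expI` whose hypotheses `hIV`, `hIV₁` are
replaced by their printed source: the (3.38)-data of `V = exp iξ𝐊` and of `U = 1` (`h338`, `hJn`, `h338₁`, `hJn₁`, rotations of cost `≤ E`,
`π` commuting with their `Ad`), the (iii)-type bounds for `V` on `X̃⁻²` with the better constants `α₀′, γ₀′` (`Eα₀′ ≤ α₀`, `Eγ₀′ ≤ α₀`),
and `ξ = L⁻ʲ` (`L^jξ = 1`, `L ≥ 1`).  The mechanism of pp. 277/280 (`U = 1`, `A′ = 𝐊`) is unchanged.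
[cite: Balaban1987RG1, (3.36) p.277 with (3.38) p.278] -/
theorem satisfies_expI_of_eq338 {F : Frame P i 𝔸} {cs : StepConsts} (hξ : 0 < cs.ξ) (hcB : 0 < cs.cB)
    (hL : 1 ≤ cs.L) (hLξ : cs.L ^ cs.j * cs.ξ = 1) {α₀ α₁ γ₀ α₀' γ₀' E : ℝ}
    (hα₀ : 0 < α₀) (heGc : ∀ A ∈ 𝓜.gc, expI cs.ξ A ∈ 𝓜.Gc) (π : 𝔸 →ₗ[ℂ] 𝔸) {K J : PBond P i → 𝔸}
    (hKgc : ∀ b ∈ F.X.bonds, K b ∈ 𝓜.gc) (hJgc : ∀ b ∈ F.X.bonds, J b ∈ 𝓜.gc) (hK0 : ∀ b ∈ F.X.bonds, ‖K b‖ < α₁)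
    (hK1 : ∀ q ∈ F.X.dpairs, ‖grad cs.ξ q.2.1 (fun y => K ⟨y, q.2.2⟩) q.1‖ < α₁)
    (hplaq : ∀ p ∈ F.X.plaqs, ‖((plaq (fun b => expI cs.ξ (K b)) p : 𝔸ˣ) : 𝔸) - 1‖ < α₀ * cs.ξ ^ 2)
    (hJ : ∀ b ∈ F.X.bonds, ‖J b‖ < γ₀)
    {w w₁ : ℕ → Site P i → 𝔸ˣ}
    (h338 : ∀ n, 1 ≤ n → n ≤ cs.j → ∀ p ∈ F.X₂.plaqs,
      plaq (F.bg.Un n (fun b => expI cs.ξ (K b))) p = plaq (gaugeU (w n) (fun b => expI cs.ξ (K b))) p)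
    (hJn : ∀ n, 1 ≤ n → n ≤ cs.j → ∀ b ∈ F.X₂.bonds,
      F.bg.Jn n (fun b => expI cs.ξ (K b)) b = current π (cs.L ^ n)⁻¹ (gaugeU (w n) (fun b => expI cs.ξ (K b))) b)
    (hπ : ∀ n x X, π (R (w n x) X) = R (w n x) (π X))
    (hw : ∀ n x, ‖(w n x : 𝔸)‖ * ‖(↑(w n x)⁻¹ : 𝔸)‖ ≤ E) (hE : 0 < E)
    (hV : ∀ p ∈ F.X₂.plaqs, ‖((plaq (fun b => expI cs.ξ (K b)) p : 𝔸ˣ) : 𝔸) - 1‖ < α₀' * cs.ξ ^ 2) (hEα : E * α₀' ≤ α₀)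
    (hJ' : ∀ b ∈ F.X₂.bonds, ‖current π cs.ξ (fun b => expI cs.ξ (K b)) b‖ < γ₀') (hEγ : E * γ₀' ≤ α₀)
    (h338₁ : ∀ n, 1 ≤ n → n ≤ cs.j → ∀ p ∈ F.X₂.plaqs,
      plaq (F.bg.Un n (1 : PBond P i → 𝔸ˣ)) p = plaq (gaugeU (w₁ n) (1 : PBond P i → 𝔸ˣ)) p)
    (hJn₁ : ∀ n, 1 ≤ n → n ≤ cs.j → ∀ b ∈ F.X₂.bonds,
      F.bg.Jn n (1 : PBond P i → 𝔸ˣ) b = current π (cs.L ^ n)⁻¹ (gaugeU (w₁ n) (1 : PBond P i → 𝔸ˣ)) b)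
    (hπ₁ : ∀ n x X, π (R (w₁ n x) X) = R (w₁ n x) (π X)) :
    Satisfies 𝓜 F cs α₀ α₁ γ₀ ⟨fun b => expI cs.ξ (K b), J⟩ :=
  B12Lemma4Concrete.satisfies_expI 𝓜 hξ hcB hα₀ heGc hKgc hJgc hK0 hK1 hplaq hJ
    (condIV_of_eq338 π hξ hL hLξ h338 hJn hπ hw hE hV hEα hJ' hEγ)
    (condIV_one_of_eq338 π hα₀ hξ hL h338₁ hJn₁ hπ₁)

end CondIV

/-! ## §6. The margin «with a bit better constant»: `e^{2B₃²O(1)Mα₀}` against the counts `1+7β`, `1+8β` -/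

section Margin

/-- **`e^{B₃²O(1)Mα₀}·e^{B₃²O(1)Mα₀} ≤ 1 + (9/64)β`** under «(4B₃²O(1)M)²α₀ ≤ β», `B₃²O(1)M ≥ 1`, `β ≤ 1`: then `B₃²O(1)Mα₀ ≤ β/16`, and
`e^{β/8} ≤ 1 + β/8 + (β/8)² ≤ 1 + 9β/64` (`Real.abs_exp_sub_one_sub_id_le`). [cite: Balaban1987RG1, (3.43) p.278] -/
theorem exp_two_mul_le {B₃ O₁ M α₀ β : ℝ} (hY : 1 ≤ B₃ ^ 2 * O₁ * M) (hα₀ : 0 ≤ α₀)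
    (hres10 : (4 * B₃ ^ 2 * O₁ * M) ^ 2 * α₀ ≤ β) (hβ1 : β ≤ 1) :
    Real.exp (B₃ ^ 2 * O₁ * M * α₀) * Real.exp (B₃ ^ 2 * O₁ * M * α₀) ≤ 1 + 9 / 64 * β := by
  set Y := B₃ ^ 2 * O₁ * M with hYdef
  have hY0 : 0 ≤ Y := by linarith
  have ha0 : 0 ≤ Y * α₀ := mul_nonneg hY0 hα₀
  have h16 : 16 * (Y * α₀) ≤ β := by
    have h1 : 16 * (Y * α₀) ≤ 16 * (Y * (Y * α₀)) := by nlinarith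
    have h2 : 16 * (Y * (Y * α₀)) = (4 * Y) ^ 2 * α₀ := by ring
    linarith
  have hβ0 : 0 ≤ β := le_trans (by positivity) h16
  rw [← Real.exp_add]
  have e : Y * α₀ + Y * α₀ = 2 * (Y * α₀) := by ring
  rw [e]
  have hx : |2 * (Y * α₀)| ≤ 1 := by
    rw [abs_of_nonneg (by positivity)]
    linarith
  have h := (abs_le.mp (Real.abs_exp_sub_one_sub_id_le hx)).2
  have hb : 2 * (Y * α₀) ≤ β / 8 := by linarith
  have hb2 : (2 * (Y * α₀)) ^ 2 ≤ (β / 8) ^ 2 := pow_le_pow_left₀ (by positivity) hb 2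
  have hb3 : (β / 8) ^ 2 ≤ β / 64 := by nlinarith
  linarith

/-- **The margin for the count `1+8β` ((3.52) / the J-budget): `e^{B₃²O(1)Mα₀}e^{B₃²O(1)Mα₀}·(1+8β)L⁻²α₀ ≤ α₀` under
«(4B₃²O(1)M)²α₀ ≤ β», `B₃²O(1)M ≥ 1`, `β ≤ 1` and the ONE extra restriction `1 + 10β ≤ L²`** (`(1 + 9β/64)(1 + 8β) ≤ 1 + 10β`).
[cite: Balaban1987RG1, (3.52) p.280 with (3.38) p.278] -/
theorem margin352 {B₃ O₁ M α₀ β L : ℝ} (hY : 1 ≤ B₃ ^ 2 * O₁ * M) (hα₀ : 0 ≤ α₀)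
    (hres10 : (4 * B₃ ^ 2 * O₁ * M) ^ 2 * α₀ ≤ β) (hβ0 : 0 ≤ β) (hβ1 : β ≤ 1) (hL : 0 < L) (hL10 : 1 + 10 * β ≤ L ^ 2) :
    Real.exp (B₃ ^ 2 * O₁ * M * α₀) * Real.exp (B₃ ^ 2 * O₁ * M * α₀) * ((1 + 8 * β) * L⁻¹ ^ 2 * α₀) ≤ α₀ := by
  have hE := exp_two_mul_le hY hα₀ hres10 hβ1
  have hprod : Real.exp (B₃ ^ 2 * O₁ * M * α₀) * Real.exp (B₃ ^ 2 * O₁ * M * α₀) * (1 + 8 * β) ≤ L ^ 2 := by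
    calc _ ≤ (1 + 9 / 64 * β) * (1 + 8 * β) := mul_le_mul_of_nonneg_right hE (by linarith)
      _ ≤ 1 + 10 * β := by nlinarith
      _ ≤ L ^ 2 := hL10
  have hL2 : 0 < L ^ 2 := by positivity
  have hnn : 0 ≤ L⁻¹ ^ 2 * α₀ := by positivity
  calc Real.exp (B₃ ^ 2 * O₁ * M * α₀) * Real.exp (B₃ ^ 2 * O₁ * M * α₀) * ((1 + 8 * β) * L⁻¹ ^ 2 * α₀)
      = (Real.exp (B₃ ^ 2 * O₁ * M * α₀) * Real.exp (B₃ ^ 2 * O₁ * M * α₀) * (1 + 8 * β)) * (L⁻¹ ^ 2 * α₀) := by ring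
    _ ≤ L ^ 2 * (L⁻¹ ^ 2 * α₀) := mul_le_mul_of_nonneg_right hprod hnn
    _ = α₀ := by rw [← mul_assoc, inv_pow, mul_inv_cancel₀ hL2.ne', one_mul]

/-- **The margin over the typed constants of Lemma 4**: `Lemma4Restrictions c` + `B₃²O(1)M ≥ 1` (unlisted, as in `B12ExpSteps`) + the one
extra restriction `1 + 10β ≤ L²` give `e^{B₃²O(1)Mα₀}e^{B₃²O(1)Mα₀}·(1+8β)L⁻²α₀ ≤ α₀` — the hypothesis `Eα₀′ ≤ α₀` of §5 for the (3.52)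
member `α₀′ = (1+8β)L⁻²α₀` and the cost `E = e^{B₃²O(1)Mα₀}e^{B₃²O(1)Mα₀}` of §1. [cite: Balaban1987RG1, (3.52) p.280 with (3.38) p.278] -/
theorem margin352_of_restrictions (c : B12Sec2to5.Lemma4Consts) (hR : B12Sec2to5.Lemma4Restrictions c)
    (hY : 1 ≤ c.B₃ ^ 2 * c.O₁ * c.M) (hL10 : 1 + 10 * c.β ≤ c.L ^ 2) :
    Real.exp (c.B₃ ^ 2 * c.O₁ * c.M * c.α₀) * Real.exp (c.B₃ ^ 2 * c.O₁ * c.M * c.α₀) *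
      ((1 + 8 * c.β) * c.L⁻¹ ^ 2 * c.α₀) ≤ c.α₀ := by
  have hR' := hR
  unfold B12Sec2to5.Lemma4Restrictions at hR'
  obtain ⟨hα₀, _, _, _, hβ, hββ₀, hβ₀, hL1, _, hres10, _, _, _, _⟩ := hR'
  exact margin352 hY hα₀.le hres10 hβ.le (by linarith) (by linarith) hL10

/-- **LOCATED: the printed list of restrictions alone leaves no margin for the rotation of (3.38).**  There are constants satisfying
`Lemma4Restrictions` and the three unlisted hypotheses of `B12ExpSteps` (`B₃ ≥ 1`, `B₃²O(1)M ≥ 1`, `16·O(1)Mα₁ ≤ β`) — e.g.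
`B₃ = O(1) = M = 1`, `L = 2`, `β = 3/8` (so `1 + 8β = L²` exactly), `β₀ = 1/2`, `α₀ = 1/256`, `α₁ = 1/64`, `α₂ = 1/100`, `α₃ = 1/10000` — for
which `e^{B₃²O(1)Mα₀}e^{B₃²O(1)Mα₀}·(1+8β)L⁻²α₀ > α₀`: the member (3.52) times the cost of `u_j(ū_j)⁻¹` exceeds the constant `α₀` of (iv).
(One more restriction of the printed kind «β not too large», `margin352_of_restrictions`, closes it.) [cite: Balaban1987RG1, (3.52) p.280 with (3.38) p.278] -/
theorem margin_not_from_restrictions : ∃ c : B12Sec2to5.Lemma4Consts, B12Sec2to5.Lemma4Restrictions c ∧ 1 ≤ c.B₃ ∧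
    1 ≤ c.B₃ ^ 2 * c.O₁ * c.M ∧ 16 * (c.O₁ * c.M * c.α₁) ≤ c.β ∧
    c.α₀ < Real.exp (c.B₃ ^ 2 * c.O₁ * c.M * c.α₀) * Real.exp (c.B₃ ^ 2 * c.O₁ * c.M * c.α₀) *
      ((1 + 8 * c.β) * c.L⁻¹ ^ 2 * c.α₀) := by
  refine ⟨⟨1, 1, 1, 2, 1 / 2, 3 / 8, 1 / 256, 1 / 64, 1 / 100, 1 / 10000⟩, ?_, by norm_num, by norm_num, by norm_num, ?_⟩
  · unfold B12Sec2to5.Lemma4Restrictions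
    norm_num
  · have h1 : (1 : ℝ) < Real.exp ((1 : ℝ) ^ 2 * 1 * 1 * (1 / 256)) := by
      have := Real.add_one_lt_exp (x := (1 : ℝ) ^ 2 * 1 * 1 * (1 / 256)) (by norm_num)
      linarith
    have h2 : ((1 : ℝ) + 8 * (3 / 8)) * (2 : ℝ)⁻¹ ^ 2 * (1 / 256) = 1 / 256 := by norm_num
    show (1 / 256 : ℝ) < _
    rw [h2]
    nlinarith [h1, Real.exp_pos ((1 : ℝ) ^ 2 * 1 * 1 * (1 / 256))]

end Margin

end

end Literature.MathematicalPhysics.QuantumFieldTheory.Balaban1983to89.B12Eq338CondIV
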